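import Summits.CriticalPhenomena.CardyFormulaZ2.Theorems.CardyIKTransportCornerLineDescentLine
import Literature.Probability.RandomPlanarGeometry.ImageUnivalent

/-!
# The frozen end `p = 0` of the corner line, part 1: freeze identification, similarity covariance, the reshape

Support file (Freeze groundwork, part 1 of 4) for the line `symmetric-seed-second-order` of the crux
`CardyIKTransport.CornerLineDescent` (stmt-CriticalPhenomena-10964), over the shared vocabulary
`Theorems/CardyIKTransportCornerLineDescentLine.lean`; it serves the registered stub `stub_FreezeHomogenisation`
(the `t = 0` end of the line: Cardy limits of the frozen gauge transfer to standard bond-`ℤ²`).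

* §A FREEZE IDENTIFICATION.  (i) The law: `Set.projIcc 0 1 _ 0 = 0` and `setBer(univ, 0) = dirac ∅`, so the syndrome
  factor of `gaugeMeasure 0` is `dirac ∅` (anchor `gaugeMeasure_zero_eq_prod`), `gaugeMeasure 0` is the push-forward
  of the four fair factors `fairBits` under "syndromes := ∅" (`gaugeMeasure_zero_eq_map`), a.s. `ω.2.2.1 = ∅`
  (`ae_syndromes_eq_empty`), and `gaugeCrossingProb 0 R δ = fairBits.real (freezeEmbed ⁻¹' crossingEvent R δ)`.
  (ii) Pathwise, no syndromes: the colouring is the plaid `A_{v0} ⊕ B_{v1}` (`gaugeColour_iff_of_empty`); the edge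
  set unfolds through `Sym2` into an ORIENTED step relation (`mem_gaugeEdges_iff`, `Step`, `Step.fwd`) with the four
  explicit cases east / north / main diagonal / anti-diagonal (valid for every `ω`).  (iii) The block structure:
  axis edges live inside maximal constant runs of `A`, `B`; inside a block all four cells of a face agree; at a grid
  vertex (both bits flip) the face is a checkerboard and the fair coin joins exactly the black diagonal pair; on a
  grid line (one bit flips) no diagonal fires.  Hence black connectivity of the frozen gauge = bond percolation at
  `½` on the diagonal-adjacency graph of the black blocks of the renewal product grid (part 2–4 make this precise).
* §B SIMILARITY COVARIANCE of `HasCrossingLimit` under `z ↦ c z (+ w)` for every conformal rectangle, family and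
  `F` (tree `ConformalRectangle.hasCrossingLimit_iff_of_image_data`), and the mesh reparametrisation `δ ↦ cδ`.
* §C THE RESHAPE.  `FreezeComparisonAt R` (finite-mesh form `gaugeCrossingProb 0 (e^{iπ/4} R) δ −
  bondStdCrossingProb R (2δ) → 0`) ⇒ `FreezeHomogenisationAt R` (`∀ R, FreezeHomogenisationAt R` = the registered
  stub `stub_FreezeHomogenisation`, verbatim) ⇒ the former stub `stub_FreezeToStandard` (`freeze_of_homogenisation`,
  proved).  Both predicates are SUB-GOALS OF THE LINE (route-posited, quantified over `R` by a registered stub), not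
  literature facts.

NORMALISATION (why `e^{iπ/4}` and `2δ`): with `X_i`, `Y_j` the flips of `A`, `B` (i.i.d. Geometric(`½`) gaps, mean
`2`), the black block `(m,n)` (`i = m−n`, `j = m+n+c`) sits at the cell position `X_i + i Y_j ≈ 2(1+i)(m + i n) +
2ic`, and `2(1+i) = 2√2·e^{iπ/4}` while `squareLatticeEmbedding.z (m,n) = √2 (m + i n)`: at mesh `δ` it is at
`e^{iπ/4}·(2δ)·squareLatticeEmbedding.z (m,n) + o(1)`.  References: route file `Theses/CardyIKTransport.lean`
(items 10964, 4967); `Cruxes/CornerLineDescent/Disproof.lean` §F; Grimmett–Manolescu, PTRF 159 (2014) §2.2. -/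

noncomputable section

namespace Summit.CriticalPhenomena.CardyFormulaZ2.Theorems.CornerLineDescent.SymmetricSeed

open scoped BigOperators Topology Classical MeasureTheory ProbabilityTheory ENNReal NNReal
open Filter Set Function MeasureTheory
open Literature.Probability.Percolation (sitePercolation bondPercolation half BondConfig embDomainCrossing rectangle)
open Literature.Probability.LatticeModels
open Literature.Probability.RandomPlanarGeometry

/-- ANCHOR OF PART 1 (registered sub-goal). THE LAW AT `p = 0`: the syndrome factor of `gaugeMeasure 0` is the Dirac
mass at the empty configuration (`Set.projIcc 0 1 _ 0 = 0`, Mathlib `setBernoulli_zero`); the other four factors are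
fair. [folklore] -/
theorem gaugeMeasure_zero_eq_prod : gaugeMeasure 0 = (sitePercolation ℤ half).prod ((sitePercolation ℤ half).prod ((Measure.dirac (∅ : Set (Site 2))).prod ((sitePercolation (Site 2) half).prod (sitePercolation (Site 2) half)))) := by
  rw [gaugeMeasure, show Set.projIcc (0:ℝ) 1 zero_le_one 0 = 0 from projIcc_eq_zero.2 le_rfl]
  simp [sitePercolation]

namespace Freeze

/-! ## §A FreezeIdentification, part (i): the law at syndrome density `p = 0` -/

/-- The four fair factors of the frozen model: column bits, row bits, the unused field, the coins. [folklore] -/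
def fairBits : Measure (Set ℤ × (Set ℤ × (Set (Site 2) × Set (Site 2)))) :=
  (sitePercolation ℤ half).prod ((sitePercolation ℤ half).prod
    ((sitePercolation (Site 2) half).prod (sitePercolation (Site 2) half)))

/-- `fairBits` is a probability measure. [folklore] -/
instance : IsProbabilityMeasure fairBits := by unfold fairBits; infer_instance

/-- Insert the empty syndrome configuration as the third factor. [folklore] -/
def freezeEmbed (ω : Set ℤ × (Set ℤ × (Set (Site 2) × Set (Site 2)))) : Bits :=
  (ω.1, ω.2.1, ∅, ω.2.2)

/-- `freezeEmbed` is measurable (a product of identities and a constant). [folklore] -/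
theorem measurable_freezeEmbed : Measurable freezeEmbed := by
  unfold freezeEmbed
  fun_prop

/-- PUSH-FORWARD FORM of the law at `p = 0`: `gaugeMeasure 0` is the image of the four fair factors under
"syndromes := ∅".  This is the form in which the frozen model is coupled to anything else. [folklore] -/
theorem gaugeMeasure_zero_eq_map : gaugeMeasure 0 = fairBits.map freezeEmbed := by
  have h3 : (Measure.dirac (∅ : Set (Site 2))).prod
      ((sitePercolation (Site 2) half).prod (sitePercolation (Site 2) half)) =
      ((sitePercolation (Site 2) half).prod (sitePercolation (Site 2) half)).map (Prod.mk ∅) :=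
    Measure.dirac_prod _
  have h2 : (sitePercolation ℤ half).prod (((sitePercolation (Site 2) half).prod
      (sitePercolation (Site 2) half)).map (Prod.mk (∅ : Set (Site 2)))) =
      ((sitePercolation ℤ half).prod ((sitePercolation (Site 2) half).prod
        (sitePercolation (Site 2) half))).map (Prod.map id (Prod.mk ∅)) := by
    rw [← Measure.map_prod_map _ _ measurable_id measurable_prodMk_left, Measure.map_id]
  have h1 : (sitePercolation ℤ half).prod (((sitePercolation ℤ half).prod
      ((sitePercolation (Site 2) half).prod (sitePercolation (Site 2) half))).map
        (Prod.map id (Prod.mk (∅ : Set (Site 2))))) =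
      fairBits.map (Prod.map id (Prod.map id (Prod.mk ∅))) := by
    rw [fairBits, ← Measure.map_prod_map _ _ measurable_id (measurable_id.prodMap measurable_prodMk_left),
      Measure.map_id]
  rw [gaugeMeasure_zero_eq_prod, h3, h2, h1]
  rfl

/-- ALMOST SURELY NO SYNDROMES at `p = 0`. [folklore] -/
theorem ae_syndromes_eq_empty : ∀ᵐ ω ∂(gaugeMeasure 0), ω.2.2.1 = ∅ := by
  rw [gaugeMeasure_zero_eq_map]
  refine (ae_map_iff measurable_freezeEmbed.aemeasurable ?_).2 (Eventually.of_forall fun _ => rfl)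
  exact (measurableSet_singleton (∅ : Set (Site 2))).preimage
    (measurable_fst.comp (measurable_snd.comp measurable_snd))

/-- The frozen crossing probability is the fair-bits probability of the pulled-back event. [folklore] -/
theorem gaugeCrossingProb_zero_eq (R : ConformalRectangle) (δ : ℝ) (hA : MeasurableSet (crossingEvent R δ)) :
    gaugeCrossingProb 0 R δ = fairBits.real (freezeEmbed ⁻¹' crossingEvent R δ) := by
  rw [gaugeCrossingProb, gaugeMeasure_zero_eq_map, measureReal_def, measureReal_def,
    Measure.map_apply measurable_freezeEmbed hA]

/-! ## §A FreezeIdentification, part (ii): pathwise, the frozen colouring is the plaid `A(v0) ⊕ B(v1)` -/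

/-- PLAID COLOURING: with no syndromes the colour of the cell `v` is `A_{v0} ⊕ B_{v1}` (the defect-parity term of
`gaugeColour` is the parity of the empty set; the fourth factor is never read at `S = univ`). [folklore] -/
theorem gaugeColour_iff_of_empty {ω : Bits} (h : ω.2.2.1 = ∅) (v : Site 2) :
    gaugeColour ω v ↔ Xor (v 0 ∈ ω.1) (v 1 ∈ ω.2.1) := by
  simp [gaugeColour, h, Xor]

/-- The saddle coin at `S = univ` is the coin bit. [folklore] -/
theorem gaugeCoin_iff' (ω : Bits) (f : Site 2) : gaugeCoin ω f ↔ f ∈ ω.2.2.2.2 := by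
  simp [gaugeCoin]

/-- The ORIENTED step relation of `gaugeEdges`: `v` is the east, north, north-east (main diagonal, coin at `u`
off) or south-east (anti-diagonal, coin at the face `u + (0,-1)` on) neighbour of `u`. [folklore] -/
def Step (ω : Bits) (u v : Site 2) : Prop :=
  v = u + ![1, 0] ∨ v = u + ![0, 1] ∨ (v = u + ![1, 1] ∧ ¬ gaugeCoin ω u) ∨
    (v = u + ![1, -1] ∧ gaugeCoin ω (u + ![0, -1]))

/-- Unfolding `gaugeEdges` through `Sym2`: the edge `s(u, v)` is black iff one of its two orientations is a black
step. [folklore] -/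
theorem mem_gaugeEdges_iff (ω : Bits) (u v : Site 2) :
    s(u, v) ∈ gaugeEdges ω ↔
      (gaugeColour ω u ∧ gaugeColour ω v ∧ Step ω u v) ∨ (gaugeColour ω v ∧ gaugeColour ω u ∧ Step ω v u) := by
  constructor
  · rintro ⟨u', v', he, hu', hv', hst⟩
    rcases Sym2.eq_iff.1 he with ⟨rfl, rfl⟩ | ⟨rfl, rfl⟩
    · exact Or.inl ⟨hu', hv', hst⟩
    · exact Or.inr ⟨hu', hv', hst⟩
  · rintro (⟨hu, hv, hst⟩ | ⟨hv, hu, hst⟩)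
    · exact ⟨u, v, rfl, hu, hv, hst⟩
    · exact ⟨v, u, Sym2.eq_swap, hv, hu, hst⟩

/-- Steps go forward: the functional `2 (v0 − u0) + (v1 − u1)` is positive along every step. [folklore] -/
theorem Step.fwd {ω : Bits} {u v : Site 2} (h : Step ω u v) : 0 < 2 * (v 0 - u 0) + (v 1 - u 1) := by
  rcases h with rfl | rfl | ⟨rfl, -⟩ | ⟨rfl, -⟩ <;> simp

/-- For a forward pair only the forward orientation can be a step. [folklore] -/
theorem mem_gaugeEdges_iff_of_fwd (ω : Bits) {u v : Site 2} (h : 0 ≤ 2 * (v 0 - u 0) + (v 1 - u 1)) :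
    s(u, v) ∈ gaugeEdges ω ↔ gaugeColour ω u ∧ gaugeColour ω v ∧ Step ω u v := by
  rw [mem_gaugeEdges_iff]
  refine ⟨?_, Or.inl⟩
  rintro (h' | ⟨-, -, hst⟩)
  · exact h'
  · have := hst.fwd; omega

/-- HORIZONTAL EDGES: `s(u, u + e₀)` is black iff both cells are black. [folklore] -/
theorem mem_gaugeEdges_east (ω : Bits) (u : Site 2) :
    s(u, u + ![1, 0]) ∈ gaugeEdges ω ↔ gaugeColour ω u ∧ gaugeColour ω (u + ![1, 0]) := by
  rw [mem_gaugeEdges_iff_of_fwd ω (by simp)]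
  simp [Step]

/-- VERTICAL EDGES: `s(u, u + e₁)` is black iff both cells are black. [folklore] -/
theorem mem_gaugeEdges_north (ω : Bits) (u : Site 2) :
    s(u, u + ![0, 1]) ∈ gaugeEdges ω ↔ gaugeColour ω u ∧ gaugeColour ω (u + ![0, 1]) := by
  rw [mem_gaugeEdges_iff_of_fwd ω (by simp)]
  simp [Step]

/-- MAIN DIAGONAL of the face with lower-left cell `u`: black iff both cells are black and the coin at `u` is
off. [folklore] -/
theorem mem_gaugeEdges_northEast (ω : Bits) (u : Site 2) :
    s(u, u + ![1, 1]) ∈ gaugeEdges ω ↔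
      gaugeColour ω u ∧ gaugeColour ω (u + ![1, 1]) ∧ u ∉ ω.2.2.2.2 := by
  rw [mem_gaugeEdges_iff_of_fwd ω (by simp)]
  simp [Step, gaugeCoin_iff']

/-- ANTI-DIAGONAL of the face with lower-left cell `u`: black iff both cells `u + e₁`, `u + e₀` are black and the
coin at `u` is on. [folklore] -/
theorem mem_gaugeEdges_southEast (ω : Bits) (u : Site 2) :
    s(u + ![0, 1], u + ![1, 0]) ∈ gaugeEdges ω ↔
      gaugeColour ω (u + ![0, 1]) ∧ gaugeColour ω (u + ![1, 0]) ∧ u ∈ ω.2.2.2.2 := by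
  rw [mem_gaugeEdges_iff_of_fwd ω (by simp)]
  have h1 : u + ![1, 0] = u + ![0, 1] + ![1, -1] := by
    rw [add_assoc, add_right_inj]; ext i; fin_cases i <;> simp
  have h2 : u + ![0, 1] + ![0, -1] = u := by
    rw [add_assoc, add_eq_left]; ext i; fin_cases i <;> simp
  refine and_congr_right fun _ => and_congr_right fun _ => ⟨?_, fun hc => ?_⟩
  · rintro (h | h | ⟨h, -⟩ | ⟨-, hc⟩)
    · rw [add_assoc, add_right_inj] at h; have := congrFun h 1; simp at this
    · rw [add_assoc, add_right_inj] at h; have := congrFun h 0; simp at this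
    · rw [add_assoc, add_right_inj] at h; have := congrFun h 1; simp at this
    · rwa [h2, gaugeCoin_iff'] at hc
  · exact Or.inr (Or.inr (Or.inr ⟨h1, by rwa [h2, gaugeCoin_iff']⟩))

/-! ## §A FreezeIdentification, part (iii): the plaid block structure (no syndromes) -/

/-- RUNS OF `A` CARRY THE HORIZONTAL EDGES: with no syndromes, `s(u, u + e₀)` is black iff `u` is black and the
column bits at `u0`, `u0 + 1` agree (so black horizontal moves stay inside a maximal constant run of `A`). [folklore] -/
theorem mem_gaugeEdges_east_iff_of_empty {ω : Bits} (h : ω.2.2.1 = ∅) (u : Site 2) :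
    s(u, u + ![1, 0]) ∈ gaugeEdges ω ↔ gaugeColour ω u ∧ (u 0 ∈ ω.1 ↔ u 0 + 1 ∈ ω.1) := by
  rw [mem_gaugeEdges_east, gaugeColour_iff_of_empty h, gaugeColour_iff_of_empty h]
  simp only [Pi.add_apply, Matrix.cons_val_zero, Matrix.cons_val_one, Matrix.cons_val_fin_one, add_zero, Xor]
  tauto

/-- RUNS OF `B` CARRY THE VERTICAL EDGES: with no syndromes, `s(u, u + e₁)` is black iff `u` is black and the row
bits at `u1`, `u1 + 1` agree. [folklore] -/
theorem mem_gaugeEdges_north_iff_of_empty {ω : Bits} (h : ω.2.2.1 = ∅) (u : Site 2) :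
    s(u, u + ![0, 1]) ∈ gaugeEdges ω ↔ gaugeColour ω u ∧ (u 1 ∈ ω.2.1 ↔ u 1 + 1 ∈ ω.2.1) := by
  rw [mem_gaugeEdges_north, gaugeColour_iff_of_empty h, gaugeColour_iff_of_empty h]
  simp only [Pi.add_apply, Matrix.cons_val_zero, Matrix.cons_val_one, Matrix.cons_val_fin_one, add_zero, Xor]
  tauto

/-- GRID VERTICES ARE CHECKERBOARD: at a face `u` where both the column bit flips (`u0 → u0+1`) and the row bit flips
(`u1 → u1+1`) — a vertex of the renewal product grid — the cells `u`, `u + (1,1)` have the same colour and the cells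
`u + e₀`, `u + e₁` the opposite one: exactly one diagonal pair is black. [folklore] -/
theorem checkerboard_of_empty {ω : Bits} (h : ω.2.2.1 = ∅) (u : Site 2)
    (hA : ¬ (u 0 ∈ ω.1 ↔ u 0 + 1 ∈ ω.1)) (hB : ¬ (u 1 ∈ ω.2.1 ↔ u 1 + 1 ∈ ω.2.1)) :
    (gaugeColour ω (u + ![1, 1]) ↔ gaugeColour ω u) ∧ (gaugeColour ω (u + ![1, 0]) ↔ ¬ gaugeColour ω u) ∧
      (gaugeColour ω (u + ![0, 1]) ↔ ¬ gaugeColour ω u) := by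
  simp only [gaugeColour_iff_of_empty h, Pi.add_apply, Matrix.cons_val_zero, Matrix.cons_val_one,
    Matrix.cons_val_fin_one, add_zero, Xor]
  tauto

/-- THE COIN JOINS EXACTLY ONE DIAGONAL PAIR AT A GRID VERTEX: at such a face, the main diagonal `s(u, u+(1,1))` is
black iff `u` is black and the coin is off, the anti-diagonal `s(u+e₁, u+e₀)` is black iff `u` is white and the coin
is on; so the black pair (whichever it is) is joined with probability `½`, independently over faces — bond
percolation at `½` on the diagonal adjacency graph of black blocks. [folklore] -/
theorem diagonals_at_vertex_of_empty {ω : Bits} (h : ω.2.2.1 = ∅) (u : Site 2)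
    (hA : ¬ (u 0 ∈ ω.1 ↔ u 0 + 1 ∈ ω.1)) (hB : ¬ (u 1 ∈ ω.2.1 ↔ u 1 + 1 ∈ ω.2.1)) :
    (s(u, u + ![1, 1]) ∈ gaugeEdges ω ↔ gaugeColour ω u ∧ u ∉ ω.2.2.2.2) ∧
      (s(u + ![0, 1], u + ![1, 0]) ∈ gaugeEdges ω ↔ ¬ gaugeColour ω u ∧ u ∈ ω.2.2.2.2) := by
  obtain ⟨h11, h10, h01⟩ := checkerboard_of_empty h u hA hB
  rw [mem_gaugeEdges_northEast, mem_gaugeEdges_southEast, h11, h10, h01]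
  tauto

/-- NO DIAGONALS OFF THE GRID VERTICES: if exactly one of the two bits flips at the face `u` (a point on a grid LINE,
not a vertex), neither diagonal pair is black-black, so no diagonal edge is present whatever the coin. [folklore] -/
theorem no_diagonal_on_line_of_empty {ω : Bits} (h : ω.2.2.1 = ∅) (u : Site 2)
    (hAB : Xor (u 0 ∈ ω.1 ↔ u 0 + 1 ∈ ω.1) (u 1 ∈ ω.2.1 ↔ u 1 + 1 ∈ ω.2.1)) :
    s(u, u + ![1, 1]) ∉ gaugeEdges ω ∧ s(u + ![0, 1], u + ![1, 0]) ∉ gaugeEdges ω := by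
  rw [mem_gaugeEdges_northEast, mem_gaugeEdges_southEast]
  simp only [gaugeColour_iff_of_empty h, Pi.add_apply, Matrix.cons_val_zero, Matrix.cons_val_one,
    Matrix.cons_val_fin_one, add_zero, Xor] at hAB ⊢
  tauto

/-- INSIDE A BLOCK THE DIAGONALS ARE REDUNDANT: if neither bit flips at the face `u`, all four cells have the colour
of `u` (and the axis edges among them are black iff `u` is black). [folklore] -/
theorem constant_in_block_of_empty {ω : Bits} (h : ω.2.2.1 = ∅) (u : Site 2)
    (hA : u 0 ∈ ω.1 ↔ u 0 + 1 ∈ ω.1) (hB : u 1 ∈ ω.2.1 ↔ u 1 + 1 ∈ ω.2.1) :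
    (gaugeColour ω (u + ![1, 1]) ↔ gaugeColour ω u) ∧ (gaugeColour ω (u + ![1, 0]) ↔ gaugeColour ω u) ∧
      (gaugeColour ω (u + ![0, 1]) ↔ gaugeColour ω u) := by
  simp only [gaugeColour_iff_of_empty h, Pi.add_apply, Matrix.cons_val_zero, Matrix.cons_val_one,
    Matrix.cons_val_fin_one, add_zero, Xor]
  tauto

/-! ## §B Similarity covariance of crossing limits; mesh reparametrisation -/

/-- SIMILARITY COVARIANCE OF `HasCrossingLimit` (all conformal rectangles, any family `p`, any `F`): the image
`R.map (similarity c hc w)` of `R` under `z ↦ c z + w` has crossing limit `F` for `p` iff `R` has — a similarity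
carries uniformizing data `(φ, x)` of `R` to `(s ∘ φ, x)` of `s R` (same real boundary preimages, same cross-ratio;
tree `ConformalRectangle.hasCrossingLimit_iff_of_image_data`, Pommerenke 1992 Cor. 2.7). [folklore] -/
theorem hasCrossingLimit_map_similarity_iff (R : ConformalRectangle) (c : ℂ) (hc : c ≠ 0) (w : ℂ)
    (p F : ℝ → ℝ) :
    ConformalRectangle.HasCrossingLimit (R.map (similarity c hc w)) p F ↔ R.HasCrossingLimit p F :=
  ConformalRectangle.hasCrossingLimit_iff_of_image_data (R := R) (S := R.map (similarity c hc w))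
    (h := fun z => c * z + w) (((differentiable_id.const_mul c).add_const w).differentiableOn)
    (fun _ _ _ _ hxy => mul_left_cancel₀ hc (add_right_cancel hxy))
    ((continuous_const.mul continuous_id).add continuous_const).continuousOn rfl fun _ => rfl

-- adapted from `Theorems/IKLinearTransport/Negative/CruxConsequences.lean` (`hasCrossingLimit_map_mulLeft_iff`)
/-- The dilation-rotation case `z ↦ c z` as a `Homeomorph.mulLeft₀` (the form used by the route's `IKQuarterTurn`,
`AnchorByRigidity`). [folklore] -/
theorem hasCrossingLimit_map_mulLeft₀_iff (R : ConformalRectangle) {c : ℂ} (hc : c ≠ 0) (p F : ℝ → ℝ) :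
    ConformalRectangle.HasCrossingLimit (R.map (Homeomorph.mulLeft₀ c hc)) p F ↔ R.HasCrossingLimit p F :=
  ConformalRectangle.hasCrossingLimit_iff_of_image_data (R := R) (S := R.map (Homeomorph.mulLeft₀ c hc))
    (h := fun z => c * z) ((differentiable_id.const_mul c).differentiableOn) (mul_right_injective₀ hc).injOn
    (continuous_const.mul continuous_id).continuousOn rfl fun _ => rfl

/-- ONE-SIDED TRANSPORT OF UNIFORMIZING DATA along `z ↦ c z`: a datum `(φ, x)` of `R` gives a datum of `c · R` with
the SAME real boundary preimages `x` (tree `MarkedDomain.IsUniformizing.image_data`). [folklore] -/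
theorem exists_isUniformizing_map_mulLeft₀ (R : ConformalRectangle) {c : ℂ} (hc : c ≠ 0)
    {φ : ConformalEquiv UpperHalfPlane.upperHalfPlaneSet R.carrier} {x : Fin 4 → ℝ} (hφ : R.IsUniformizing φ x) :
    ∃ ψ : ConformalEquiv UpperHalfPlane.upperHalfPlaneSet (R.map (Homeomorph.mulLeft₀ c hc)).carrier,
      MarkedDomain.IsUniformizing (R.map (Homeomorph.mulLeft₀ c hc)) ψ x :=
  ⟨_, hφ.image_data (S := R.map (Homeomorph.mulLeft₀ c hc)) (h := fun z => c * z)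
    ((differentiable_id.const_mul c).differentiableOn) (mul_right_injective₀ hc).injOn
    (continuous_const.mul continuous_id).continuousOn rfl fun _ => rfl⟩

/-- Dilations of the mesh fix the filter `𝓝[>] 0`. [folklore] -/
theorem tendsto_const_mul_nhdsGT_zero {c : ℝ} (hc : 0 < c) :
    Tendsto (fun δ : ℝ => c * δ) (𝓝[>] 0) (𝓝[>] 0) := by
  refine tendsto_nhdsWithin_iff.2 ⟨?_, ?_⟩
  · have h : Tendsto (fun δ : ℝ => c * δ) (𝓝 0) (𝓝 (c * 0)) := (continuous_const_mul c).tendsto 0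
    rw [mul_zero] at h
    exact h.mono_left nhdsWithin_le_nhds
  · exact eventually_mem_nhdsWithin.mono fun δ hδ => mul_pos hc hδ

/-- MESH REPARAMETRISATION: convergence along `δ → 0⁺` is invariant under `δ ↦ c δ`, `c > 0`. [folklore] -/
theorem tendsto_comp_const_mul_nhdsGT_zero_iff {β : Type*} (f : ℝ → β) {c : ℝ} (hc : 0 < c) (l : Filter β) :
    Tendsto (fun δ => f (c * δ)) (𝓝[>] 0) l ↔ Tendsto f (𝓝[>] 0) l := by
  refine ⟨fun h => ?_, fun h => h.comp (tendsto_const_mul_nhdsGT_zero hc)⟩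
  have h' := h.comp (tendsto_const_mul_nhdsGT_zero (inv_pos.2 hc))
  have hfun : (fun δ => f (c * δ)) ∘ (fun δ : ℝ => c⁻¹ * δ) = f := by
    funext δ
    simp only [Function.comp_apply, mul_inv_cancel_left₀ hc.ne']
  rwa [hfun] at h'

/-! ## §C The reshape: the frozen end as ONE lattice statement plus proved glue -/

/-- The eighth turn `e^{iπ/4}`, written `Complex.exp (↑(π/4) * I)` so that registered signatures can spell it with
Mathlib alone (no new vocabulary): `e^{iπ/4} = (1 + i)/√2` (`eighthTurn_eq`). [folklore] -/
abbrev eighthTurn : ℂ := Complex.exp (((Real.pi / 4 : ℝ) : ℂ) * Complex.I)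

/-- `e^{iπ/4} = √2/2 + i √2/2`. [folklore] -/
theorem eighthTurn_eq : eighthTurn = ⟨Real.sqrt 2 / 2, Real.sqrt 2 / 2⟩ := by
  rw [eighthTurn, Complex.exp_mul_I, ← Complex.ofReal_cos, ← Complex.ofReal_sin, Real.cos_pi_div_four,
    Real.sin_pi_div_four]
  apply Complex.ext <;> simp

/-- `e^{iπ/4} ≠ 0`. [folklore] -/
theorem eighthTurn_ne_zero : eighthTurn ≠ 0 := Complex.exp_ne_zero _

/-- `√2 · e^{iπ/4} = 1 + i`. [folklore] -/
theorem sqrt_two_mul_eighthTurn : (Real.sqrt 2 : ℂ) * eighthTurn = 1 + Complex.I := by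
  have h2 : Real.sqrt 2 * Real.sqrt 2 = 2 := Real.mul_self_sqrt zero_le_two
  rw [eighthTurn_eq]
  refine Complex.ext ?_ ?_
  · simp only [Complex.mul_re, Complex.ofReal_re, Complex.ofReal_im, Complex.add_re, Complex.one_re, Complex.I_re]
    linear_combination h2 / 2
  · simp only [Complex.mul_im, Complex.ofReal_re, Complex.ofReal_im, Complex.add_im, Complex.one_im, Complex.I_im]
    linear_combination h2 / 2

/-- `(e^{iπ/4})² = i`. [folklore] -/
theorem eighthTurn_mul_self : eighthTurn * eighthTurn = Complex.I := by
  have h2 : Real.sqrt 2 * Real.sqrt 2 = 2 := Real.mul_self_sqrt zero_le_two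
  rw [eighthTurn_eq]
  refine Complex.ext ?_ ?_
  · simp only [Complex.mul_re, Complex.I_re]
    linear_combination (0:ℝ) * h2
  · simp only [Complex.mul_im, Complex.I_im]
    linear_combination h2 / 2

/-- `|e^{iπ/4}| = 1`: the eighth turn is a rotation. [folklore] -/
theorem norm_eighthTurn : ‖eighthTurn‖ = 1 := by
  rw [eighthTurn, Complex.norm_exp_ofReal_mul_I]

/-- The rotation of the plane by `+π/4` about the origin, as the homeomorphism `Homeomorph.mulLeft₀ e^{iπ/4}` (the
form in which the route rotates rectangles, cf. `IKQuarterTurn`); registered signatures spell it out literally. [folklore] -/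
abbrev rotEighth : ℂ ≃ₜ ℂ :=
  Homeomorph.mulLeft₀ (Complex.exp (((Real.pi / 4 : ℝ) : ℂ) * Complex.I)) (Complex.exp_ne_zero _)

/-- `FreezeComparisonAt R` — THE FROZEN END AS A FINITE-MESH COMPARISON at the conformal rectangle `R` (in-law
freeze identification + renewal-grid homogenisation; both sides are bond-`ℤ²` at `½`, no Cardy content; a predicate
the line posits, quantified over `R` by its users): `gaugeCrossingProb 0 (e^{iπ/4} R) δ − bondStdCrossingProb R (2δ)
→ 0` as `δ → 0⁺` (normalisation: module docstring — black blocks of the frozen gauge at mesh `δ` sit at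
`e^{iπ/4}·(2δ)·squareLatticeEmbedding.z (m,n) + o(1)` and carry i.i.d. fair diagonal bonds).  Intended proof: the
renewal-grid coupling, the law of large numbers for the grid, and mesh-uniform continuity of crude bond-`ℤ²` crossing
probabilities in the discretisation of the domain. [folklore] -/
def FreezeComparisonAt (R : ConformalRectangle) : Prop :=
  Tendsto (fun δ => gaugeCrossingProb 0
      (R.map (Homeomorph.mulLeft₀ (Complex.exp (((Real.pi / 4 : ℝ) : ℂ) * Complex.I)) (Complex.exp_ne_zero _))) δ -
    bondStdCrossingProb R (2 * δ)) (𝓝[>] 0) (𝓝 0)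

/-- `FreezeHomogenisationAt R` — THE WEAKER LIMIT-TRANSFER FORM at `R` (what the glue consumes; `∀ R,
FreezeHomogenisationAt R` is verbatim the registered stub `stub_FreezeHomogenisation`): for every `L`, if the frozen
gauge crossing probabilities of the rotated rectangle `e^{iπ/4} R` converge to `L` then the standard bond-`ℤ²` crossing
probabilities of `R` converge to `L` (the mesh factor `2` is invisible along `𝓝[>] 0`,
`tendsto_comp_const_mul_nhdsGT_zero_iff`).  Implied by `FreezeComparisonAt R`
(`freezeHomogenisationAt_of_comparisonAt`). [folklore] -/
def FreezeHomogenisationAt (R : ConformalRectangle) : Prop :=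
  ∀ L : ℝ,
    Tendsto (gaugeCrossingProb 0
        (R.map (Homeomorph.mulLeft₀ (Complex.exp (((Real.pi / 4 : ℝ) : ℂ) * Complex.I)) (Complex.exp_ne_zero _))))
      (𝓝[>] 0) (𝓝 L) →
    Tendsto (bondStdCrossingProb R) (𝓝[>] 0) (𝓝 L)

/-- The finite-mesh comparison implies the limit transfer. [folklore] -/
theorem freezeHomogenisationAt_of_comparisonAt {R : ConformalRectangle} (h : FreezeComparisonAt R) :
    FreezeHomogenisationAt R := by
  intro L hL
  have h2 : Tendsto (fun δ => bondStdCrossingProb R (2 * δ)) (𝓝[>] 0) (𝓝 L) := by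
    have := hL.sub h
    simp only [sub_sub_cancel, sub_zero] at this
    exact this
  exact (tendsto_comp_const_mul_nhdsGT_zero_iff (bondStdCrossingProb R) two_pos _).1 h2

/-- THE GLUE (proved): limit transfer on every rotated rectangle implies the former registered stub
`stub_FreezeToStandard`.  Given Cardy for the frozen gauge in EVERY conformal rectangle, apply it to the rotated
rectangle `e^{iπ/4} R` with the transported uniformizing datum `(e^{iπ/4} ∘ φ, x)` (same `x`,
`exists_isUniformizing_map_mulLeft₀`), then transfer the limit `F(crossRatio x)` to the standard family of `R`.
[folklore] -/
theorem freeze_of_homogenisation (h : ∀ R : ConformalRectangle, FreezeHomogenisationAt R) :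
    (∀ R : ConformalRectangle, R.HasCrossingLimit (gaugeCrossingProb 0 R) cardyFunction) →
      ∀ R : ConformalRectangle, R.HasCrossingLimit (bondStdCrossingProb R) cardyFunction := by
  intro hg R φ x hφx
  obtain ⟨ψ, hψ⟩ := exists_isUniformizing_map_mulLeft₀ R eighthTurn_ne_zero hφx
  exact h R _ (hg (R.map rotEighth) ψ x hψ)

end Freeze

end Summit.CriticalPhenomena.CardyFormulaZ2.Theorems.CornerLineDescent.SymmetricSeed
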